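import Summits.AtomisticToContinuum.FouriersLaw.Theorems.HiddenChargeMazurStaticKuboStubCorrectorLipschitzAux
import HarnessLib

/-!
# `HiddenChargeMazur.StaticKubo`, line `birth` (rev 4), stub `stub_correctorLipschitz` —
a weighted pair-Lipschitz bound for the Kubo corrector

Helper file (`--supports stmt-AtomisticToContinuum-13510`, crux decl `HiddenChargeMazur.StaticKubo`,
registered stub `stub_correctorLipschitz` (S6) of the skeleton `Cruxes/StaticKubo/Lines/birth.lean`, rev 4).

Given the one-step Doeblin–Fortet inequality (the core of S5, taken as HYPOTHESIS): for the pinned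
anharmonic chain `pinnedChain ω₂ lam β γ` (all parameters `> 0`), `N ≥ 2`, `T > 0`, `0 < θ₁ < 1/(2T)`,
the everywhere-defined Kubo corrector `u⋆(x) = ∫_{(0,∞)} P_tJ(x) dt` (`J = Σ_i bondCurrent i`,
`P_t = transitionKernel N T T t`) satisfies `|u⋆(x) − u⋆(y)| ≤ A‖x−y‖(e^{θ₁H(x)} + e^{θ₁H(y)})` for
`‖x−y‖ ≤ 1`.

Proof (the recursion): with `ϑ = θ₁/2` and the dyadic pieces `φ_n = ∫_{(n,n+1]} P_tJ dt` of the aux file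
(`stub_correctorLipschitz_dyadicPackage`: `|φ_n| ≤ MCe^{-cn}e^{ϑH}`, `P_1φ_n = φ_{n+1}`, `u⋆ = Σ_n φ_n`),
the pair constant of `φ_0` is `≤ C₀` (hypothesis (b), integrated over `(0,1]`), and hypothesis (a) gives
`K_{n+1} ≤ K_n/2 + C₀MCe^{-cn}`; the closed majorant `K_n = (C₀ + (D/ρ)n)ρ^n`, `ρ = max(1/2, e^{-c})`,
is summable, and `A = Σ_n K_n`. Continuity of each `φ_n` (needed by (a)) follows from its pair bound.

References: Cuneo–Eckmann–Hairer–Rey-Bellet, EJP 23 (2018) no. 55, Thm 2.13; Lasota–Yorke / Doeblin–Fortet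
(the recursion); Kundu–Dhar–Narayan 2009 (the Kubo corrector). Nothing here closes the item.
-/

noncomputable section

open MeasureTheory Filter Topology
open scoped NNReal ENNReal
open Literature.MathematicalPhysics.KineticTheory.HeatConduction Literature.MathematicalPhysics.KineticTheory
open Literature.Probability.Process OscillatorChain

namespace Summit.AtomisticToContinuum.FouriersLaw.Cruxes.StaticKubo.Birth.Stubs

/-- **Continuity from a weighted pair bound**: if `|φ x − φ y| ≤ K‖x−y‖(e^{θHx} + e^{θHy})` whenever
`‖x − y‖ ≤ 1`, with `H` continuous, then `φ` is continuous. [folklore] -/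
theorem correctorLipschitz_continuous_of_pairBound {N : ℕ} {Hm φ : PhaseSpace N → ℝ} (hH : Continuous Hm) {K θ : ℝ}
    (h : ∀ x y, ‖x - y‖ ≤ 1 → |φ x - φ y| ≤ K * ‖x - y‖ * (Real.exp (θ * Hm x) + Real.exp (θ * Hm y))) :
    Continuous φ := by
  refine continuous_iff_continuousAt.2 fun x => ?_
  rw [ContinuousAt, tendsto_iff_norm_sub_tendsto_zero]
  have hB : Tendsto (fun y => K * ‖y - x‖ * (Real.exp (θ * Hm y) + Real.exp (θ * Hm x))) (𝓝 x) (𝓝 0) := by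
    have hc : Continuous fun y => K * ‖y - x‖ * (Real.exp (θ * Hm y) + Real.exp (θ * Hm x)) := by
      fun_prop
    simpa using hc.tendsto x
  refine squeeze_zero' (Eventually.of_forall fun y => norm_nonneg _) ?_ hB
  filter_upwards [Metric.closedBall_mem_nhds x one_pos] with y hy
  rw [Real.norm_eq_abs]
  exact h y x (by rwa [Metric.mem_closedBall, dist_eq_norm] at hy)

/-- **The summable majorant of the pair constants**: for `C₀, D ≥ 0`, `c > 0` there is `K : ℕ → ℝ`,
`K ≥ 0`, `K 0 = C₀`, `K n/2 + D e^{-cn} ≤ K (n+1)`, `Σ_n K n < ∞` — namely `K n = (C₀ + (D/ρ) n) ρ^n`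
with `ρ = max (1/2) e^{-c} < 1`. [folklore] -/
theorem correctorLipschitz_exists_summable_pairMajorant {C₀ D c : ℝ} (hC₀ : 0 ≤ C₀) (hD : 0 ≤ D) (hc : 0 < c) :
    ∃ K : ℕ → ℝ, K 0 = C₀ ∧ (∀ n, 0 ≤ K n) ∧
      (∀ n : ℕ, K n / 2 + D * Real.exp (-c * n) ≤ K (n + 1)) ∧ Summable K := by
  set ρ : ℝ := max (1 / 2) (Real.exp (-c)) with hρ
  have hρ0 : 0 < ρ := lt_max_of_lt_left one_half_pos
  have hρ1 : ρ < 1 := max_lt (by norm_num) (Real.exp_lt_one_iff.2 (by linarith))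
  have hρne : ρ ≠ 0 := hρ0.ne'
  have hhalf : (1 : ℝ) / 2 ≤ ρ := le_max_left _ _
  have hexp : Real.exp (-c) ≤ ρ := le_max_right _ _
  refine ⟨fun n => (C₀ + D / ρ * n) * ρ ^ n, by simp, fun n => by dsimp only; positivity,
    fun n => ?_, ?_⟩
  · show (C₀ + D / ρ * n) * ρ ^ n / 2 + D * Real.exp (-c * n) ≤
      (C₀ + D / ρ * ((n + 1 : ℕ) : ℝ)) * ρ ^ (n + 1)
    rw [Nat.cast_add_one]
    have hpow : Real.exp (-c * n) ≤ ρ ^ n := by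
      rw [show -c * (n : ℝ) = n * (-c) by ring, Real.exp_nat_mul]
      exact pow_le_pow_left₀ (Real.exp_pos _).le hexp n
    have h1 : (C₀ + D / ρ * n) * ρ ^ n / 2 ≤ (C₀ + D / ρ * n) * ρ ^ n * ρ := by
      rw [div_eq_mul_one_div]
      exact mul_le_mul_of_nonneg_left hhalf (by positivity)
    have h2 : D * Real.exp (-c * n) ≤ D * ρ ^ n := mul_le_mul_of_nonneg_left hpow hD
    calc (C₀ + D / ρ * n) * ρ ^ n / 2 + D * Real.exp (-c * n)
        ≤ (C₀ + D / ρ * n) * ρ ^ n * ρ + D * ρ ^ n := add_le_add h1 h2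
      _ = (C₀ + D / ρ * (n + 1)) * ρ ^ (n + 1) := by
          field_simp
          ring
  · have hg1 : Summable fun n : ℕ => ρ ^ n := summable_geometric_of_lt_one hρ0.le hρ1
    have hg2 : Summable fun n : ℕ => (n : ℝ) ^ 1 * ρ ^ n :=
      summable_pow_mul_geometric_of_norm_lt_one 1 (by rw [Real.norm_of_nonneg hρ0.le]; exact hρ1)
    refine ((hg1.mul_left C₀).add (hg2.mul_left (D / ρ))).congr fun n => ?_
    ring

/-- **S6 — `stub_correctorLipschitz` (the recursion: a weighted pair-Lipschitz bound for the Kubo corrector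
`u⋆ = ∫₀^∞ P_tJ dt`), proved.**  Given the core of S5: with `φ_n(x) := ∫_{(n,n+1]} P_tJ(x) dt` one has
`P_1φ_n = φ_{n+1}` (Chapman–Kolmogorov + Fubini), `|φ_n| ≤ MC e^{-cn} e^{ϑH}` (`totalBondCurrent_decay`,
`ϑ = θ₁/2`), the pair constant of `φ_0` is `≤ C₀` (S5 (b)) and `K_{n+1} ≤ K_n/2 + C₀MCe^{-cn}` (S5 (a)); so
`Σ_n K_n < ∞`, and `u⋆ = Σ_n φ_n` pointwise (absolute convergence); `A = Σ_n K_n`.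
[cite: CuneoEckmannHairerReyBellet2018, Thm 2.13 eq. (2.5)] -/
theorem stub_correctorLipschitz :
    (∀ ω₂ lam β γ : ℝ, 0 < ω₂ → 0 < lam → 0 < β → 0 < γ → ∀ N : ℕ, 2 ≤ N → ∀ T : ℝ, 0 < T →
      ∀ ϑ θ₁ : ℝ, 0 < ϑ → ϑ < θ₁ → θ₁ < 1 / (2 * T) →
      ∃ C₀ : ℝ, 0 ≤ C₀ ∧
        (∀ φ : PhaseSpace N → ℝ, Continuous φ → ∀ Mφ Kφ : ℝ, 0 ≤ Mφ → 0 ≤ Kφ →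
          (∀ x, |φ x| ≤ Mφ * Real.exp (ϑ * (pinnedChain ω₂ lam β γ).hamiltonian N x)) →
          (∀ x y, ‖x - y‖ ≤ 1 → |φ x - φ y| ≤ Kφ * ‖x - y‖ *
            (Real.exp (θ₁ * (pinnedChain ω₂ lam β γ).hamiltonian N x) +
              Real.exp (θ₁ * (pinnedChain ω₂ lam β γ).hamiltonian N y))) →
          ∀ x y, ‖x - y‖ ≤ 1 →
            |(∫ z, φ z ∂((pinnedChain ω₂ lam β γ).transitionKernel N T T 1 x)) -
                ∫ z, φ z ∂((pinnedChain ω₂ lam β γ).transitionKernel N T T 1 y)| ≤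
              (Kφ / 2 + C₀ * Mφ) * ‖x - y‖ *
                (Real.exp (θ₁ * (pinnedChain ω₂ lam β γ).hamiltonian N x) +
                  Real.exp (θ₁ * (pinnedChain ω₂ lam β γ).hamiltonian N y))) ∧
        (∀ t : ℝ≥0, (t : ℝ) ≤ 1 → ∀ x y : PhaseSpace N, ‖x - y‖ ≤ 1 →
          |(∫ z, (∑ i : Fin N, (pinnedChain ω₂ lam β γ).bondCurrent N i z)
                ∂((pinnedChain ω₂ lam β γ).transitionKernel N T T t x)) -
              ∫ z, (∑ i : Fin N, (pinnedChain ω₂ lam β γ).bondCurrent N i z)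
                ∂((pinnedChain ω₂ lam β γ).transitionKernel N T T t y)| ≤
            C₀ * ‖x - y‖ *
              (Real.exp (θ₁ * (pinnedChain ω₂ lam β γ).hamiltonian N x) +
                Real.exp (θ₁ * (pinnedChain ω₂ lam β γ).hamiltonian N y)))) →
    ∀ ω₂ lam β γ : ℝ, 0 < ω₂ → 0 < lam → 0 < β → 0 < γ → ∀ N : ℕ, 2 ≤ N → ∀ T : ℝ, 0 < T →
      ∀ θ₁ : ℝ, 0 < θ₁ → θ₁ < 1 / (2 * T) →
      ∃ A : ℝ, ∀ x y : PhaseSpace N, ‖x - y‖ ≤ 1 →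
        |(∫ t in Set.Ioi (0 : ℝ), ∫ z, (∑ i : Fin N, (pinnedChain ω₂ lam β γ).bondCurrent N i z)
              ∂((pinnedChain ω₂ lam β γ).transitionKernel N T T t.toNNReal x)) -
            ∫ t in Set.Ioi (0 : ℝ), ∫ z, (∑ i : Fin N, (pinnedChain ω₂ lam β γ).bondCurrent N i z)
              ∂((pinnedChain ω₂ lam β γ).transitionKernel N T T t.toNNReal y)| ≤
          A * ‖x - y‖ *
            (Real.exp (θ₁ * (pinnedChain ω₂ lam β γ).hamiltonian N x) +
              Real.exp (θ₁ * (pinnedChain ω₂ lam β γ).hamiltonian N y)) := by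
  intro hLY ω₂ lam β γ hω hl hβ hγ N hN T hT θ₁ hθ₁ hθ₁T
  have hN' : 0 < N := by omega
  -- the exponents `ϑ = θ₁/2 < θ₁ < 1/(2T) < 1/T`
  have hϑ : 0 < θ₁ / 2 := by positivity
  have hϑθ : θ₁ / 2 < θ₁ := by linarith
  have h2T : 1 / (2 * T) ≤ 1 / T := by
    rw [div_le_div_iff_of_pos_left one_pos (by positivity) hT]; linarith
  have hϑT : θ₁ / 2 < 1 / T := by linarith [hθ₁T.trans_le h2T]
  -- the one-step inequality (hypothesis) at `(ϑ, θ₁)`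
  obtain ⟨C₀, hC₀, hPa, hPb⟩ := hLY ω₂ lam β γ hω hl hβ hγ N hN T hT (θ₁ / 2) θ₁ hϑ hϑθ hθ₁T
  -- the dyadic pieces of the corrector (aux file)
  obtain ⟨g, hg⟩ : ∃ g : ℝ → PhaseSpace N → ℝ, g = fun t x =>
      ∫ z, (∑ i : Fin N, (pinnedChain ω₂ lam β γ).bondCurrent N i z)
        ∂((pinnedChain ω₂ lam β γ).transitionKernel N T T t.toNNReal x) := ⟨_, rfl⟩
  obtain ⟨φ, hφ⟩ : ∃ φ : ℕ → PhaseSpace N → ℝ, φ = fun (n : ℕ) (x : PhaseSpace N) =>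
      ∫ t in Set.Ioc (n : ℝ) (n + 1), g t x := ⟨_, rfl⟩
  obtain ⟨M, C, c, hM, hC, hc, hval, hInt, hstep, hsum⟩ :=
    stub_correctorLipschitz_dyadicPackage ω₂ lam β γ hω hl hβ hγ N hN' T hT (θ₁ / 2) hϑ hϑT g hg φ hφ
  -- the pair constants
  have hD : 0 ≤ C₀ * (M * C) := by positivity
  obtain ⟨K, hK0, hKnn, hKrec, hKsum⟩ := correctorLipschitz_exists_summable_pairMajorant hC₀ hD hc
  set Hm := (pinnedChain ω₂ lam β γ).hamiltonian N with hHm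
  have hHc : Continuous Hm := pinnedChain_continuous_hamiltonian ω₂ lam β γ N
  -- the pair bound of `φ_0` (hypothesis (b) integrated over `(0,1]`)
  have hφ0 : ∀ x, φ 0 x = ∫ t in Set.Ioc (0 : ℝ) 1, g t x := fun x => by simp [hφ]
  have hpair0 : ∀ x y : PhaseSpace N, ‖x - y‖ ≤ 1 →
      |φ 0 x - φ 0 y| ≤ K 0 * ‖x - y‖ * (Real.exp (θ₁ * Hm x) + Real.exp (θ₁ * Hm y)) := by
    intro x y hxy
    rw [hK0, hφ0, hφ0, ← integral_sub ((hInt x).mono_set Set.Ioc_subset_Ioi_self)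
      ((hInt y).mono_set Set.Ioc_subset_Ioi_self), ← Real.norm_eq_abs]
    have hlt : (volume : Measure ℝ) (Set.Ioc (0 : ℝ) 1) < ∞ := measure_Ioc_lt_top
    calc ‖∫ t in Set.Ioc (0 : ℝ) 1, (g t x - g t y)‖
        ≤ (C₀ * ‖x - y‖ * (Real.exp (θ₁ * Hm x) + Real.exp (θ₁ * Hm y))) *
            (volume : Measure ℝ).real (Set.Ioc (0 : ℝ) 1) :=
          norm_setIntegral_le_of_norm_le_const hlt fun t ht => by
            rw [Real.norm_eq_abs]
            have ht1 : ((t.toNNReal : ℝ≥0) : ℝ) ≤ 1 := by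
              rw [Real.coe_toNNReal t ht.1.le]; exact ht.2
            have h := hPb t.toNNReal ht1 x y hxy
            rw [hg]
            exact h
      _ = _ := by rw [Real.volume_real_Ioc_of_le zero_le_one, sub_zero, mul_one]
  -- the recursion: pair bounds of all `φ_n` by induction (hypothesis (a) and `P_1φ_n = φ_{n+1}`)
  have hpair : ∀ (n : ℕ) (x y : PhaseSpace N), ‖x - y‖ ≤ 1 →
      |φ n x - φ n y| ≤ K n * ‖x - y‖ * (Real.exp (θ₁ * Hm x) + Real.exp (θ₁ * Hm y)) := by
    intro n
    induction n with
    | zero => exact hpair0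
    | succ n ih =>
      intro x y hxy
      have hcont : Continuous (φ n) := correctorLipschitz_continuous_of_pairBound hHc ih
      have hMφ : 0 ≤ M * C * Real.exp (-c * n) := by positivity
      have h := hPa (φ n) hcont (M * C * Real.exp (-c * n)) (K n) hMφ (hKnn n) (hval n) ih x y hxy
      rw [hstep n x, hstep n y] at h
      refine h.trans ?_
      have hW : 0 ≤ ‖x - y‖ * (Real.exp (θ₁ * Hm x) + Real.exp (θ₁ * Hm y)) := by positivity
      have hr : K n / 2 + C₀ * (M * C * Real.exp (-c * n)) ≤ K (n + 1) := by
        calc K n / 2 + C₀ * (M * C * Real.exp (-c * n))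
            = K n / 2 + C₀ * (M * C) * Real.exp (-c * n) := by ring
          _ ≤ K (n + 1) := hKrec n
      calc (K n / 2 + C₀ * (M * C * Real.exp (-c * n))) * ‖x - y‖ *
            (Real.exp (θ₁ * Hm x) + Real.exp (θ₁ * Hm y))
          = (K n / 2 + C₀ * (M * C * Real.exp (-c * n))) *
              (‖x - y‖ * (Real.exp (θ₁ * Hm x) + Real.exp (θ₁ * Hm y))) := by ring
        _ ≤ K (n + 1) * (‖x - y‖ * (Real.exp (θ₁ * Hm x) + Real.exp (θ₁ * Hm y))) :=
            mul_le_mul_of_nonneg_right hr hW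
        _ = _ := by ring
  -- summation: `u⋆ = Σ_n φ_n` and `A = Σ_n K_n`
  refine ⟨∑' n, K n, fun x y hxy => ?_⟩
  have h1 := (hsum x).sub (hsum y)
  have h2 : HasSum (fun n => K n * ‖x - y‖ * (Real.exp (θ₁ * Hm x) + Real.exp (θ₁ * Hm y)))
      ((∑' n, K n) * ‖x - y‖ * (Real.exp (θ₁ * Hm x) + Real.exp (θ₁ * Hm y))) :=
    (hKsum.hasSum.mul_right _).mul_right _
  have h3 := HasSum.norm_le_of_bounded h1 h2 fun n => by
    rw [Real.norm_eq_abs]; exact hpair n x y hxy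
  rw [Real.norm_eq_abs, hg] at h3
  exact h3

end Summit.AtomisticToContinuum.FouriersLaw.Cruxes.StaticKubo.Birth.Stubs

end
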